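import Summits.ABC.IUTFork.Cor312UnionCoverShells
import HarnessLib

/-!
# [IUTchIII] Cor. 3.12 — the UNION-COVER bed P♮ᵤ (honest plane model), I-b: the integral tensors, the balls, the closure lemma, the movers

Record-only file (D-0012; MODEL DATA + folklore lemmas, no `Prop` fact, nothing asserted about print) of the abc-iut cell (IUT REPAIR branch B,
sub-cell B3 Joshi, seat abc-iut-rp-j1 gen 4; rung LADDER-ABC:A2.RP), sequel of `Cor312UnionCoverShells` (plane shells `ℚ²` over `toyIndex` with Ism the
STABILISER of the log-shell `ℤ²`, coordinates `coord c` of `(ℚ²)^{⊗(j+1)}`, the coordinate calculus `coord_permute` / `coord_fs` / `fs_symm_apply`).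
TAKES NO SIDE on [IUTchIII] Cor. 3.12 and no side between Mochizuki, Scholze–Stix, Joshi or Dupuy–Hilado. CONTENT:
* `latt` — the INTEGRAL TENSORS `Λ_j = (ℤ²)^{⊗(j+1)}` (all `2^{j+1}` coordinates integral); `ball p k` — the polydisc `p^k·Λ_j` (all coordinates of
  depth `≥ k`); `ball_subset_ball_iff` (STRICT nesting, witnessed by `p^k·e_c`), `mem_ball_iff` (`p^kΛ_j = p^k • Λ_j`);
* `Integral Φ` («`Φ` and `Φ⁻¹` preserve every `Λ_j`») and **THE CLOSURE LEMMA `integral_of_mem_closure`**: every element of ⟨(Ind1)∪(Ind2)⟩ of the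
  plane shells is a lattice automorphism of every packet ((Ind1): capsule permutations, `coord_permute`; (Ind2): Kronecker matrices of shell
  stabilisers, `coord_fs`; one `Subgroup.closure_induction`), hence carries every ball `p^kΛ_j` ONTO itself (`Integral.image_ball`) — the ISOMETRY
  content of Step (x) of the printed proof ([IUTchIII] Cor. 3.12, Step (x); [IUTchIV] Thm. 1.10 Step (v)) at interface level, for an INFINITE group;
* the MOVERS: `sl2 s t u v` (integer matrix of determinant `1`; `sl2_mem_stab`: `SL₂(ℤ) ⊆ stab`), the (Ind2)-family `lastMover g` acting by `g` on the
  LAST tensor factor only («independent copies of Ism on each of the direct summands of the j+1 factors», Thm. 3.11 (i) (Ind2)) with its TWO-TERM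
  coordinate formula `coord_lastMover`, and Bézout's `exists_sl2_kill`: for integers `(a, b)`, `b ≠ 0`, some `g ∈ SL₂(ℤ)` has second row killing
  `(a, b)` — the transitivity of `GL₂(ℤ)` on primitive vectors that drives the union cover of part III.
HONEST SCOPE: interface-level toy (mechanism «basis-mixing shell-stabilising (Ind2)»); Ism is read as Dupuy–Hilado's `Aut(K_v ; 𝓘_v)`, NOT as print's
Galois-induced isometries (rigid on the log-lattice: abc-iut-c312-1 `Thm311RealInd2IsmScalar`) — the bed's one reading choice, said again in parts II–III.
No judgement on print; standard axioms. [claim: Mochizuki2012, status: disputed] for every IUT noun. [cite: DupuyHilado2020, §4.7, §6.2]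
-/

noncomputable section

open Set

namespace Summit.ABC.IUTFork.Cor312Vol

namespace UnionWitness

open Thm311 Cor312 Cor312.Checks Cor312.IdentifiedNonVacuity Literature.IUT.LogThetaLattice

/-! ## 4. The integral tensors `Λ_j`, the balls `p^k Λ_j`, and the closure lemma: ⟨(Ind1)∪(Ind2)⟩ acts by lattice automorphisms -/

/-- The INTEGRAL TENSORS `Λ_j = (ℤ²)^{⊗(j+1)}`: all `2^{j+1}` coordinates integral (the unit polydisc / tensor-packet log-shell of the bed).
[claim: Mochizuki2012, status: disputed] -/
def latt (j : toyIndex.Label) (vQ : toyIndex.VQ) : Set (plane.Packet j vQ) := {x | ∀ c, IsInt (coord j vQ c x)}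

/-- The BALL `p^k · Λ_j`: all coordinates of depth `≥ k` (the polydisc `p^k𝒪 ⊗ ⋯`; `k = 0` is `Λ_j`). [claim: Mochizuki2012, status: disputed] -/
def ball (p : ℕ) (j : toyIndex.Label) (vQ : toyIndex.VQ) (k : ℕ) : Set (plane.Packet j vQ) := {x | ∀ c, Deep p k (coord j vQ c x)}

/-- `ball 0 = Λ_j`. [folklore] -/
theorem ball_zero (p : ℕ) (j : toyIndex.Label) (vQ : toyIndex.VQ) : ball p j vQ 0 = latt j vQ :=
  Set.ext fun _ => forall_congr' fun _ => deep_zero_iff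

/-- Balls are nested: `ball k ⊆ ball k'` for `k' ≤ k`. [folklore] -/
theorem ball_antitone (p : ℕ) (j : toyIndex.Label) (vQ : toyIndex.VQ) {k k' : ℕ} (h : k' ≤ k) : ball p j vQ k ⊆ ball p j vQ k' :=
  fun _ hx c => (hx c).mono h

/-- Every ball lies in `Λ_j` (it is relatively compact). [folklore] -/
theorem ball_subset_latt (p : ℕ) (j : toyIndex.Label) (vQ : toyIndex.VQ) (k : ℕ) : ball p j vQ k ⊆ latt j vQ :=
  fun _ hx c => (hx c).isInt

/-- `0` lies in every ball (balls are nonempty). [folklore] -/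
theorem zero_mem_ball (p : ℕ) (j : toyIndex.Label) (vQ : toyIndex.VQ) (k : ℕ) : (0 : plane.Packet j vQ) ∈ ball p j vQ k :=
  fun c => by rw [map_zero]; exact Deep.zero p k

/-- Elementary tensors are integral. [folklore] -/
theorem ePt_mem_latt (j : toyIndex.Label) (vQ : toyIndex.VQ) (c : toyIndex.Caps j → Bool) : ePt j vQ c ∈ latt j vQ := fun c' => by
  rw [coord_ePt]; split_ifs
  · exact isInt_one
  · exact isInt_zero

/-- `p^k · e_c` lies in the ball `p^k Λ_j` … [folklore] -/
theorem smul_ePt_mem_ball (p : ℕ) (j : toyIndex.Label) (vQ : toyIndex.VQ) (k : ℕ) (c : toyIndex.Caps j → Bool) :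
    ((p : ℚ) ^ k) • ePt j vQ c ∈ ball p j vQ k := fun c' => by
  rw [map_smul, smul_eq_mul]; exact deep_pow_mul (ePt_mem_latt j vQ c c')

/-- … and in the ball `p^{k'} Λ_j` exactly when `k' ≤ k` (`p ≥ 2`): the witness of STRICT nesting. [folklore] -/
theorem smul_ePt_mem_ball_iff {p : ℕ} (hp : 2 ≤ p) (j : toyIndex.Label) (vQ : toyIndex.VQ) (k k' : ℕ) (c : toyIndex.Caps j → Bool) :
    ((p : ℚ) ^ k) • ePt j vQ c ∈ ball p j vQ k' ↔ k' ≤ k := by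
  refine ⟨fun h => ?_, fun h => ball_antitone p j vQ h (smul_ePt_mem_ball p j vQ k c)⟩
  have h1 := h c
  rw [map_smul, smul_eq_mul, coord_ePt, if_pos rfl, mul_one] at h1
  exact (deep_pow_iff hp).1 h1

/-- **Balls are STRICTLY nested**: `ball k ⊆ ball k' ↔ k' ≤ k` (`p ≥ 2`). [folklore] -/
theorem ball_subset_ball_iff {p : ℕ} (hp : 2 ≤ p) (j : toyIndex.Label) (vQ : toyIndex.VQ) (k k' : ℕ) :
    ball p j vQ k ⊆ ball p j vQ k' ↔ k' ≤ k :=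
  ⟨fun h => (smul_ePt_mem_ball_iff hp j vQ k k' fun _ => true).1 (h (smul_ePt_mem_ball p j vQ k _)), ball_antitone p j vQ⟩

/-- Distinct depths give distinct balls (`p ≥ 2`). [folklore] -/
theorem ball_injective {p : ℕ} (hp : 2 ≤ p) (j : toyIndex.Label) (vQ : toyIndex.VQ) {k k' : ℕ} (h : ball p j vQ k = ball p j vQ k') : k = k' :=
  le_antisymm ((ball_subset_ball_iff hp j vQ k' k).1 h.symm.subset) ((ball_subset_ball_iff hp j vQ k k').1 h.subset)

/-- A ball is `p^k` times the lattice: `x ∈ p^kΛ_j ↔ x = p^k · y` with `y ∈ Λ_j` (`p ≠ 0`). [folklore] -/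
theorem mem_ball_iff {p : ℕ} (hp : p ≠ 0) (j : toyIndex.Label) (vQ : toyIndex.VQ) (k : ℕ) (x : plane.Packet j vQ) :
    x ∈ ball p j vQ k ↔ ∃ y ∈ latt j vQ, x = ((p : ℚ) ^ k) • y := by
  have hpk : ((p : ℚ) ^ k) ≠ 0 := pow_ne_zero k (by exact_mod_cast hp)
  constructor
  · intro hx
    refine ⟨((p : ℚ) ^ k)⁻¹ • x, fun c => ?_, by rw [smul_smul, mul_inv_cancel₀ hpk, one_smul]⟩
    obtain ⟨n, hn⟩ := hx c
    refine ⟨n, ?_⟩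
    rw [map_smul, smul_eq_mul, hn, ← mul_assoc, inv_mul_cancel₀ hpk, one_mul]
  · rintro ⟨y, hy, rfl⟩ c
    rw [map_smul, smul_eq_mul]; exact deep_pow_mul (hy c)

/-- A packet-automorphism family is INTEGRAL if it and its inverse preserve the integral tensors of every packet (a family of lattice
automorphisms — the isometry content of Step (x) at interface level). [folklore] -/
structure Integral (Φ : plane.PacketAut) : Prop where
  /-- `Φ(Λ_j) ⊆ Λ_j` -/
  fwd : ∀ (j : toyIndex.Label) (vQ : toyIndex.VQ) (x : plane.Packet j vQ), x ∈ latt j vQ → Φ j vQ x ∈ latt j vQ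
  /-- `Φ⁻¹(Λ_j) ⊆ Λ_j` -/
  bwd : ∀ (j : toyIndex.Label) (vQ : toyIndex.VQ) (x : plane.Packet j vQ), x ∈ latt j vQ → (Φ j vQ).symm x ∈ latt j vQ

/-- The identity family is integral. [folklore] -/
theorem integral_one : Integral 1 := ⟨fun _ _ _ hx => hx, fun _ _ _ hx => hx⟩

/-- Integral families are closed under composition. [folklore] -/
theorem Integral.mul {Φ Ψ : plane.PacketAut} (hΦ : Integral Φ) (hΨ : Integral Ψ) : Integral (Φ * Ψ) :=
  ⟨fun j vQ x hx => by
    show Φ j vQ (Ψ j vQ x) ∈ latt j vQ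
    exact hΦ.fwd j vQ _ (hΨ.fwd j vQ x hx),
   fun j vQ x hx => by
    show (Ψ j vQ).symm ((Φ j vQ).symm x) ∈ latt j vQ
    exact hΨ.bwd j vQ _ (hΦ.bwd j vQ x hx)⟩

/-- Integral families are closed under inverses. [folklore] -/
theorem Integral.inv' {Φ : plane.PacketAut} (hΦ : Integral Φ) : Integral Φ⁻¹ :=
  ⟨fun j vQ x hx => by
    show (Φ j vQ).symm x ∈ latt j vQ
    exact hΦ.bwd j vQ x hx,
   fun j vQ x hx => by
    show (Φ j vQ).symm.symm x ∈ latt j vQ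
    rw [LinearEquiv.symm_symm]; exact hΦ.fwd j vQ x hx⟩

/-- A capsule permutation preserves the integral tensors. [folklore] -/
theorem permute_mem_latt (j : toyIndex.Label) (vQ : toyIndex.VQ) (σ : Equiv.Perm (toyIndex.Caps j)) {x : plane.Packet j vQ}
    (hx : x ∈ latt j vQ) : plane.permute j vQ σ x ∈ latt j vQ := fun c => by
  rw [coord_permute]; exact hx _

/-- A factor- and summand-wise family of shell-stabilising automorphisms preserves the integral tensors. [folklore] -/
theorem fs_mem_latt (j : toyIndex.Label) (vQ : toyIndex.VQ)
    (g : toyIndex.Caps j → ∀ v : toyIndex.Fibre vQ, plane.carrier v.1 ≃ₗ[ℚ] plane.carrier v.1) (hg : ∀ i v, g i v ∈ stab)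
    {x : plane.Packet j vQ} (hx : x ∈ latt j vQ) : plane.factorwise j vQ (fun i => plane.summandwise vQ (g i)) x ∈ latt j vQ := fun c => by
  rw [coord_fs]
  exact IsInt.sum _ fun c' _ => (IsInt.prod _ fun i _ => isInt_ent (hg i _) _ _).mul (hx c')

/-- **Every (Ind1)-family of the plane shells is integral** (capsule permutations; the strip-automorphism part is trivial). [folklore] -/
theorem integral_of_mem_Ind1Family {Φ : plane.PacketAut} (h : Φ ∈ plane.Ind1Family) : Integral Φ := by
  have key : ∀ (j : toyIndex.Label) (vQ : toyIndex.VQ), ∃ σ : Equiv.Perm (toyIndex.Caps j), ∀ x, Φ j vQ x = plane.permute j vQ σ x := by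
    intro j vQ
    obtain ⟨σ, hh, hmem, hΦ⟩ := h j
    refine ⟨σ, fun x => ?_⟩
    rw [show Φ j vQ = (plane.permute j vQ σ).trans (plane.factorwise j vQ fun i => plane.summandwise vQ fun v => hh i v.1) from hΦ vQ]
    have hs : (fun i => plane.summandwise vQ fun v => hh i v.1) = fun _ => LinearEquiv.refl ℚ (plane.Packet1 vQ) := by
      funext i
      have : (fun v : toyIndex.Fibre vQ => hh i v.1) = fun v => LinearEquiv.refl ℚ (plane.carrier v.1) := funext fun v => hmem i v.1
      rw [this]; exact plane.summandwise_refl vQ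
    rw [hs, plane.factorwise_refl]
    rfl
  refine ⟨fun j vQ x hx => ?_, fun j vQ x hx => ?_⟩
  · obtain ⟨σ, hσ⟩ := key j vQ
    rw [hσ]; exact permute_mem_latt j vQ σ hx
  · obtain ⟨σ, hσ⟩ := key j vQ
    have h1 : Φ j vQ = plane.permute j vQ σ := LinearEquiv.ext hσ
    rw [h1]
    show (PiTensorProduct.reindex ℚ (fun _ : toyIndex.Caps j => plane.Packet1 vQ) σ).symm x ∈ latt j vQ
    rw [PiTensorProduct.reindex_symm]
    exact permute_mem_latt j vQ σ.symm hx

/-- **Every (Ind2)-family of the plane shells is integral** (independent shell-stabilising automorphisms on every factor). [folklore] -/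
theorem integral_of_mem_Ind2Family {Φ : plane.PacketAut} (h : Φ ∈ plane.Ind2Family) : Integral Φ := by
  refine ⟨fun j vQ x hx => ?_, fun j vQ x hx => ?_⟩
  · obtain ⟨g, hg, hΦ⟩ := h j vQ
    rw [hΦ]; exact fs_mem_latt j vQ g hg hx
  · obtain ⟨g, hg, hΦ⟩ := h j vQ
    rw [hΦ, fs_symm_apply]
    exact fs_mem_latt j vQ (fun i v => (g i v).symm) (fun i v => symm_mem_stab (hg i v)) hx

/-- **THE CLOSURE LEMMA: every element of ⟨(Ind1)∪(Ind2)⟩ of the plane shells is integral** — one induction. [folklore] -/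
theorem integral_of_mem_closure {Φ : plane.PacketAut} (h : Φ ∈ Subgroup.closure (plane.Ind1Family ∪ plane.Ind2Family)) : Integral Φ := by
  induction h using Subgroup.closure_induction with
  | mem Ψ hΨ =>
    rcases hΨ with h1 | h2
    · exact integral_of_mem_Ind1Family h1
    · exact integral_of_mem_Ind2Family h2
  | one => exact integral_one
  | mul Ψ Ψ' _ _ hΨ hΨ' => exact hΨ.mul hΨ'
  | inv Ψ _ hΨ => exact hΨ.inv'

/-- An integral family carries `Λ_j` ONTO `Λ_j`. [folklore] -/
theorem Integral.image_latt {Φ : plane.PacketAut} (hΦ : Integral Φ) (j : toyIndex.Label) (vQ : toyIndex.VQ) :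
    Φ j vQ '' latt j vQ = latt j vQ := by
  refine Set.Subset.antisymm ?_ fun y hy => ⟨(Φ j vQ).symm y, hΦ.bwd j vQ y hy, LinearEquiv.apply_symm_apply _ _⟩
  rintro _ ⟨x, hx, rfl⟩; exact hΦ.fwd j vQ x hx

/-- **An integral family carries every ball `p^kΛ_j` ONTO itself** (it is an ISOMETRY of the polydisc frame: Step (x)). [folklore] -/
theorem Integral.image_ball {Φ : plane.PacketAut} (hΦ : Integral Φ) {p : ℕ} (hp : p ≠ 0) (j : toyIndex.Label) (vQ : toyIndex.VQ) (k : ℕ) :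
    Φ j vQ '' ball p j vQ k = ball p j vQ k := by
  apply Set.Subset.antisymm
  · rintro _ ⟨x, hx, rfl⟩
    obtain ⟨y, hy, rfl⟩ := (mem_ball_iff hp j vQ k x).1 hx
    rw [LinearEquiv.map_smul]
    exact (mem_ball_iff hp j vQ k _).2 ⟨_, hΦ.fwd j vQ y hy, rfl⟩
  · intro z hz
    obtain ⟨y, hy, rfl⟩ := (mem_ball_iff hp j vQ k z).1 hz
    refine ⟨((p : ℚ) ^ k) • (Φ j vQ).symm y, (mem_ball_iff hp j vQ k _).2 ⟨_, hΦ.bwd j vQ y hy, rfl⟩, ?_⟩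
    rw [LinearEquiv.map_smul, LinearEquiv.apply_symm_apply]

/-! ## 5. The movers: `SL₂(ℤ)` in the stabiliser, the last-factor (Ind2)-family, Bézout -/

/-- The plane automorphism with INTEGER matrix `(s t ; u v)` of determinant `s·v − t·u = 1` (rows indexed `false`, `true`). [folklore] -/
def sl2 (s t u v : ℤ) (h : s * v - t * u = 1) : (Bool → ℚ) ≃ₗ[ℚ] (Bool → ℚ) where
  toFun y := vec2 ((s : ℚ) * y false + t * y true) ((u : ℚ) * y false + v * y true)
  map_add' y z := by
    funext r; cases r <;> simp only [vec2, cond_true, cond_false, Pi.add_apply] <;> ring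
  map_smul' a y := by
    funext r; cases r <;> simp only [vec2, cond_true, cond_false, Pi.smul_apply, smul_eq_mul, RingHom.id_apply] <;> ring
  invFun y := vec2 ((v : ℚ) * y false - t * y true) (-(u : ℚ) * y false + s * y true)
  left_inv y := by
    have h' : (s : ℚ) * v - t * u = 1 := by exact_mod_cast h
    funext r; cases r <;> simp only [vec2, cond_true, cond_false]
    · linear_combination (y false) * h'
    · linear_combination (y true) * h'
  right_inv y := by
    have h' : (s : ℚ) * v - t * u = 1 := by exact_mod_cast h
    funext r; cases r <;> simp only [vec2, cond_true, cond_false]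
    · linear_combination (y false) * h'
    · linear_combination (y true) * h'

/-- The action of `sl2 s t u v`: `y ↦ (s·y_f + t·y_t, u·y_f + v·y_t)`. [folklore] -/
theorem sl2_apply (s t u v : ℤ) (h : s * v - t * u = 1) (y : Bool → ℚ) :
    sl2 s t u v h y = vec2 ((s : ℚ) * y false + t * y true) ((u : ℚ) * y false + v * y true) := rfl

/-- The action of the inverse of `sl2 s t u v`: `y ↦ (v·y_f − t·y_t, −u·y_f + s·y_t)`. [folklore] -/
theorem sl2_symm_apply (s t u v : ℤ) (h : s * v - t * u = 1) (y : Bool → ℚ) :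
    (sl2 s t u v h).symm y = vec2 ((v : ℚ) * y false - t * y true) (-(u : ℚ) * y false + s * y true) := rfl

/-- The matrix entries of `sl2 s t u v` in the row `true` are `u`, `v`. [folklore] -/
theorem ent_sl2_true (s t u v : ℤ) (h : s * v - t * u = 1) :
    ent (sl2 s t u v h) true false = u ∧ ent (sl2 s t u v h) true true = v := by
  constructor <;> simp [ent, sl2_apply, vec2, bvec]

/-- **`sl2 s t u v` stabilises the log-shell** (`SL₂(ℤ) ⊆ GL₂(ℤ) = stab`). [folklore] -/
theorem sl2_mem_stab (s t u v : ℤ) (h : s * v - t * u = 1) : sl2 s t u v h ∈ stab := by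
  refine mem_stab_of_isInt (fun r b => ?_) (fun r b => ?_)
  · cases r <;> cases b <;> simp only [ent, sl2_apply, vec2, bvec, cond_true, cond_false, Bool.false_eq_true, Bool.true_eq_false,
      if_true, if_false, mul_one, mul_zero, add_zero, zero_add] <;> exact isInt_intCast _
  · cases r <;> cases b <;> simp only [ent, sl2_symm_apply, vec2, bvec, cond_true, cond_false, Bool.false_eq_true, Bool.true_eq_false,
      if_true, if_false, mul_one, mul_zero, add_zero, zero_add, sub_zero, zero_sub] <;> exact isInt_intCast _

/-- The factors of the LAST-FACTOR family: `g` on the last factor `j ∈ S^±_{j+1}`, the identity on the others. [folklore] -/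
def lastFactors (g : (Bool → ℚ) ≃ₗ[ℚ] (Bool → ℚ)) (j : toyIndex.Label) (vQ : toyIndex.VQ) :
    toyIndex.Caps j → ∀ v : toyIndex.Fibre vQ, plane.carrier v.1 ≃ₗ[ℚ] plane.carrier v.1 :=
  fun i _ => if i = Fin.last _ then g else LinearEquiv.refl ℚ (Bool → ℚ)

/-- **The LAST-FACTOR (Ind2)-family `lastMover g`**: on every packet, `g` acts on (the one summand of) the LAST tensor factor and the identity
on the other factors («independent copies of Ism on each of the direct summands of the j+1 factors», [IUTchIII] Thm. 3.11 (i) (Ind2)).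
[claim: Mochizuki2012, status: disputed] -/
def lastMover (g : (Bool → ℚ) ≃ₗ[ℚ] (Bool → ℚ)) : plane.PacketAut := fun j vQ =>
  plane.factorwise j vQ fun i => plane.summandwise vQ (lastFactors g j vQ i)

/-- `lastMover g` is an (Ind2)-family when `g` stabilises the log-shell. [folklore] -/
theorem lastMover_mem_Ind2Family {g : (Bool → ℚ) ≃ₗ[ℚ] (Bool → ℚ)} (hg : g ∈ stab) : lastMover g ∈ plane.Ind2Family := fun j vQ =>
  ⟨lastFactors g j vQ, fun i v => by
    unfold lastFactors; split_ifs
    · exact hg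
    · exact refl_mem_stab, rfl⟩

/-- `lastMover g` lies in ⟨(Ind1)∪(Ind2)⟩ when `g` stabilises the log-shell. [folklore] -/
theorem lastMover_mem_closure {g : (Bool → ℚ) ≃ₗ[ℚ] (Bool → ℚ)} (hg : g ∈ stab) :
    lastMover g ∈ Subgroup.closure (plane.Ind1Family ∪ plane.Ind2Family) :=
  Subgroup.subset_closure (Or.inr (lastMover_mem_Ind2Family hg))

/-- **The two-term coordinate formula of the last-factor family**: on a coordinate `c`, `lastMover g` mixes ONLY the two coordinates that agree
with `c` off the last factor: `coord c (lastMover g · x) = (g)_{c j, false}·coord c[j ↦ false] x + (g)_{c j, true}·coord c[j ↦ true] x`. [folklore] -/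
theorem coord_lastMover (g : (Bool → ℚ) ≃ₗ[ℚ] (Bool → ℚ)) (j : toyIndex.Label) (vQ : toyIndex.VQ) (c : toyIndex.Caps j → Bool)
    (x : plane.Packet j vQ) :
    coord j vQ c (lastMover g j vQ x) =
      ent g (c (Fin.last _)) false * coord j vQ (Function.update c (Fin.last _) false) x +
        ent g (c (Fin.last _)) true * coord j vQ (Function.update c (Fin.last _) true) x := by
  have h : (coord j vQ c).comp (lastMover g j vQ).toLinearMap =
      ent g (c (Fin.last _)) false • coord j vQ (Function.update c (Fin.last _) false) +
        ent g (c (Fin.last _)) true • coord j vQ (Function.update c (Fin.last _) true) := by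
    apply PiTensorProduct.ext
    ext y
    show coord j vQ c (plane.factorwise j vQ (fun i => plane.summandwise vQ (lastFactors g j vQ i)) (plane.tprod j vQ y)) =
      (ent g (c (Fin.last _)) false • coord j vQ (Function.update c (Fin.last _) false) +
        ent g (c (Fin.last _)) true • coord j vQ (Function.update c (Fin.last _) true)) (plane.tprod j vQ y)
    rw [LinearMap.add_apply, LinearMap.smul_apply, LinearMap.smul_apply, plane.factorwise_summandwise_tprod]
    simp only [smul_eq_mul]
    show coord j vQ c (PiTensorProduct.tprod ℚ fun i v => lastFactors g j vQ i v (y i v)) =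
      ent g (c (Fin.last _)) false * coord j vQ (Function.update c (Fin.last _) false) (PiTensorProduct.tprod ℚ y) +
        ent g (c (Fin.last _)) true * coord j vQ (Function.update c (Fin.last _) true) (PiTensorProduct.tprod ℚ y)
    rw [coord_tprod, coord_tprod, coord_tprod, Fin.prod_univ_castSucc, Fin.prod_univ_castSucc, Fin.prod_univ_castSucc]
    have hne : ∀ i : Fin (j : ℕ), (Fin.castSucc i : toyIndex.Caps j) ≠ Fin.last _ := fun i => (Fin.castSucc_lt_last i).ne
    simp only [lastFactors, if_neg (hne _), if_true, Function.update_of_ne (hne _), Function.update_self, LinearEquiv.refl_apply]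
    rw [apply_eq_sum, Fintype.sum_bool]
    ring
  have h' := congrArg (fun f : plane.Packet j vQ →ₗ[ℚ] ℚ => f x) h
  simp only [LinearMap.comp_apply, LinearEquiv.coe_coe, LinearMap.add_apply, LinearMap.smul_apply, smul_eq_mul] at h'
  exact h'

/-- **Bézout's mover**: for integers `a`, `b` with `b ≠ 0` there is an integer matrix of determinant `1` whose second row `(u, v)` KILLS `(a, b)`:
`u·a + v·b = 0` (complete the primitive vector `(b, −a)/gcd` to a basis of `ℤ²` — the transitivity of `GL₂(ℤ)` on primitive vectors). [folklore] -/
theorem exists_sl2_kill (a b : ℤ) (hb : b ≠ 0) : ∃ s t u v : ℤ, s * v - t * u = 1 ∧ u * a + v * b = 0 := by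
  have hg : 0 < Int.gcd a b := Int.gcd_pos_of_ne_zero_right a hb
  obtain ⟨g, a', b', -, hco, ha, hb'⟩ := Int.exists_gcd_one' hg
  have hbez : ((Int.gcd a' b' : ℕ) : ℤ) = a' * Int.gcdA a' b' + b' * Int.gcdB a' b' := Int.gcd_eq_gcd_ab a' b'
  rw [hco, Nat.cast_one] at hbez
  refine ⟨-Int.gcdA a' b', -Int.gcdB a' b', b', -a', by linear_combination -hbez, ?_⟩
  rw [ha, hb']; ring

end UnionWitness

end Summit.ABC.IUTFork.Cor312Vol

end
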